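import Summits.Ventures.HodgeRepro.Night4ReducedDimEightAbelian
import Summits.Ventures.HodgeRepro.Night4ReducedDimTransport
import Summits.Ventures.HodgeRepro.Night4ReducedDimRoute

/-!
# Degree 8 in general: `dim B_red ∈ {6, 7, 8}` for every face of every `(G, c)` of order 8 — modulo the classification of
the groups of order 8 — and the degree-8 frontier as «HC in codimension 2 for abelian varieties of dimension ≤ 8»

Blind re-derivation cell `pub-hodge-repro`, seat `night-4` (ROUTE HARDENING for the Monday FINAL, gen 4).  Target tree
path `lean/Summits/Ventures/HodgeRepro/Night4ReducedDimEightRoute.lean`.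

Parts I / II (`Night4ReducedDimEight`, `Night4ReducedDimEightAbelian`) put ROUTE.md §3.3's table on the kernel for the
SEVEN NAMED pairs `(G, c)` of order 8 of the typer's `Groups.lean`.  Gen 1 transported the degree-6 count to an ABSTRACT
`(G, c)` of order 6 through its own proof that every such pair is `(C6, cc_C6)` (`Night4ReducedDimTransport`).  For order
8 the corresponding classification — «every `(G, c)` with `|G| = 8` and `c` a central involution is one of `(C8, cc_C8)`,
`(C4 × C2, cc_C4xC2_sq | _ns | _ns')`, `(C2 × C2 × C2, cc_C2xC2xC2)`, `(D4, cc_D4)`, `(Q8, cc_Q8)`» — is p6's `classify8`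
(proofs/p6/Classify8.lean), which is NOT landed; re-proving it is not this file's business.  This file therefore

* NAMES the classification: `Order8Classified c` (the five-way disjunction, exactly `classify8`'s conclusion) and
  `Night4Classify8` (its universal form — p6's theorem as a `Prop`), carried as a HYPOTHESIS, never asserted;
* proves, modulo it, the count for EVERY `(G, c)` of order 8: `redDim_faceCorners_of_order8` (transport along the
  isomorphism, then parts I / II), `redDim_of_sumTwo_of_order8` (every `SumTwo` quadruple without conjugate corners —
  a face up to relabelling, the typer's `isFace_of_sumTwo_of_card_le_eight'`), and on the route's type data
  `TypeDatum.redDim_of_order8` (every face of every degree-8 datum has `redDim ∈ {6, 7, 8}`);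
* at route level (`Route`): `RedDimDeg8` (a THEOREM from `Night4Classify8`), `ReducedDimLeEight_deg8_of_DimReduced`
  (with the cell's dictionary `DimReduced`: `B_red` is an abelian variety of dimension `6`, `7` or `8`), and
  `S4facesDeg8_of_HC2_le_eight : AlgPull → LemmaR_faces → DimReduced → Night4Classify8 → HC2_dim_le 8 → S4facesDeg 8`
  — the degree-8 analogue of gen 1's `S4facesDeg6_of_Markman'`: what would close the degree-8 frontier is the Hodge
  conjecture in codimension 2 for abelian varieties of dimension ≤ 8 (the reduced products `A × E × E′`, `A × S`,
  `S × S′ × S″`, `A × S × E`, `A₁ × A₂`, `A × S × S′`, `S₁ × S₂ × S₃ × S₄` of ROUTE.md §3.3 / §3.5 (i)); Markman's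
  Corollary 1.3 is its `≤ 5` case.

Nothing here says anything about the status of the Hodge conjecture for CM abelian varieties, which is NOT proved.
-/

set_option autoImplicit false

open Finset
open scoped Pointwise

namespace HodgeRepro

/-! ## The classification of the groups of order 8 with a central involution, as a named hypothesis -/

section Order8

variable {G : Type} [Group G] [Fintype G] [DecidableEq G]

/-- **`(G, c)` is one of the seven named pairs of order 8** — the conclusion of p6's `classify8` (proofs/p6/Classify8.lean,
NOT landed: "Groups of order 8 with a central involution: `(G, c)` is isomorphic to one of the explicit pairs of
`Groups.lean`"), as a predicate on `(G, c)`. -/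
def Order8Classified (c : G) : Prop :=
  (∃ e : G ≃* C8, e c = cc_C8) ∨
  (∃ e : G ≃* C4xC2, e c = cc_C4xC2_sq ∨ e c = cc_C4xC2_ns ∨ e c = cc_C4xC2_ns') ∨
  (∃ e : G ≃* C2xC2xC2, e c = cc_C2xC2xC2) ∨
  (∃ e : G ≃* D4, e c = cc_D4) ∨ (∃ e : G ≃* Q8, e c = cc_Q8)

omit [DecidableEq G] in
/-- A classified pair has order 8. -/
theorem Order8Classified.card_eq_eight {c : G} (h : Order8Classified c) : Fintype.card G = 8 := by
  rcases h with ⟨e, -⟩ | ⟨e, -⟩ | ⟨e, -⟩ | ⟨e, -⟩ | ⟨e, -⟩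
  · rw [← card_eq_of_mulEquiv e, card_C8]
  · rw [← card_eq_of_mulEquiv e, card_C4xC2]
  · rw [← card_eq_of_mulEquiv e, card_C2xC2xC2]
  · rw [← card_eq_of_mulEquiv e, card_D4]
  · rw [← card_eq_of_mulEquiv e, card_Q8]

end Order8

/-- **The classification of the groups of order 8 with a central involution** (p6's `classify8`, NOT landed), as a `Prop`:
every `(G, c)` with `|G| = 8` and `c` a central involution is one of the seven named pairs.  A HYPOTHESIS here (the
classification is elementary group theory — an element of order 8, or of order 4 with the abelian / dihedral / quaternion
cases, or exponent 2 — but its proof is p6's, not this seat's); nothing asserted. -/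
def Night4Classify8 : Prop :=
  ∀ (G : Type) [Group G] [Fintype G] [DecidableEq G] (c : G), Fintype.card G = 8 → IsComplexConj c →
    Order8Classified c

/-! ## Transport of a face statement along an isomorphism -/

section Transport

variable {G G' : Type} [Group G] [Group G'] [Fintype G] [Fintype G'] [DecidableEq G] [DecidableEq G']

/-- A property of `redDim (faceCorners c Φ p p′)` that holds for every face of `(G′, e c)` holds for every face of
`(G, c)`: transport along `e` (`redDim_mapSet`, `mapSet_faceCorners`, `IsCMType.map`, `mapSet_place`). -/
theorem redDim_faceCorners_transport (e : G ≃* G') {c : G} (P : ℕ → Prop)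
    (h : ∀ (Φ' : Finset G') (p₁ p₂ : G'), IsCMType (e c) Φ' → p₂ ∉ place (e c) p₁ →
      P (redDim (faceCorners (e c) Φ' p₁ p₂)))
    {Φ : Finset G} (hΦ : IsCMType c Φ) {p p' : G} (hp : p' ∉ place c p) : P (redDim (faceCorners c Φ p p')) := by
  rw [← redDim_mapSet e]
  have hface : (fun i => mapSet e (faceCorners c Φ p p' i)) = faceCorners (e c) (mapSet e Φ) (e p) (e p') := by
    funext i
    rw [mapSet_faceCorners]
  rw [hface]
  refine h _ _ _ (hΦ.map e) ?_
  rw [← mapSet_place, mem_mapSet, MulEquiv.symm_apply_apply]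
  exact hp

end Transport

/-! ## Degree 8 in general, modulo the classification -/

section General

variable {G : Type} [Group G] [Fintype G] [DecidableEq G]

/-- **Every census face of every classified `(G, c)` of order 8 has `dim B_red ∈ {6, 7, 8}`** (ROUTE.md §3.3 «dim B_red
6–8»): transport to the named pair and parts I / II. -/
theorem redDim_faceCorners_of_order8 {c : G} (hcl : Order8Classified c) {Φ : Finset G} (hΦ : IsCMType c Φ)
    {p p' : G} (hp : p' ∉ place c p) :
    redDim (faceCorners c Φ p p') = 6 ∨ redDim (faceCorners c Φ p p') = 7 ∨ redDim (faceCorners c Φ p p') = 8 := by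
  rcases hcl with ⟨e, hec⟩ | ⟨e, hec | hec | hec⟩ | ⟨e, hec⟩ | ⟨e, hec⟩ | ⟨e, hec⟩ <;>
    refine redDim_faceCorners_transport e (fun n => n = 6 ∨ n = 7 ∨ n = 8) (fun Φ' p₁ p₂ hΦ' hp' => ?_) hΦ hp <;>
    rw [hec] at hΦ' hp' ⊢
  · exact Or.inr (Or.inr (redDim_faceCorners_C8 Φ' p₁ p₂ hΦ' hp'))
  · rcases redDim_faceCorners_C4xC2_sq Φ' p₁ p₂ hΦ' hp' with h | h
    · exact Or.inl h
    · exact Or.inr (Or.inr h)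
  · rcases redDim_faceCorners_C4xC2_ns Φ' p₁ p₂ hΦ' hp' with h | h
    · exact Or.inl h
    · exact Or.inr (Or.inl h)
  · rcases redDim_faceCorners_C4xC2_ns' Φ' p₁ p₂ hΦ' hp' with h | h
    · exact Or.inl h
    · exact Or.inr (Or.inl h)
  · exact Or.inl (redDim_faceCorners_C2xC2xC2 Φ' p₁ p₂ hΦ' hp')
  · rcases redDim_faceCorners_D4 Φ' p₁ p₂ hΦ' hp' with h | h
    · exact Or.inl h
    · exact Or.inr (Or.inr h)
  · exact Or.inr (Or.inr (redDim_faceCorners_Q8 Φ' p₁ p₂ hΦ' hp'))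

/-- The bounds `6 ≤ dim B_red ≤ 8`, for convenience. -/
theorem redDim_faceCorners_of_order8_bounds {c : G} (hcl : Order8Classified c) {Φ : Finset G}
    (hΦ : IsCMType c Φ) {p p' : G} (hp : p' ∉ place c p) :
    6 ≤ redDim (faceCorners c Φ p p') ∧ redDim (faceCorners c Φ p p') ≤ 8 := by
  rcases redDim_faceCorners_of_order8 hcl hΦ hp with h | h | h <;> omega

/-- **Every `SumTwo` quadruple of CM types of a classified `(G, c)` of order 8 with no two corners conjugate has
`redDim ∈ {6, 7, 8}`** — it is a census face up to relabelling (the typer's `isFace_of_sumTwo_of_card_le_eight'`). -/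
theorem redDim_of_sumTwo_of_order8 {c : G} (hcl : Order8Classified c) (hc : IsComplexConj c) {T : Fin 4 → Finset G}
    (hT : ∀ i, IsCMType c (T i)) (hsum : SumTwo T) (hconj : ∀ i j, i ≠ j → T j ≠ c • T i) :
    redDim T = 6 ∨ redDim T = 7 ∨ redDim T = 8 := by
  have h8 := hcl.card_eq_eight
  obtain ⟨a, b, d, π, π', ha, hb, hd, hab, had, hbd, -, -, hpl, h1, h2, h3⟩ :=
    isFace_of_sumTwo_of_card_le_eight' hc hT hsum hconj (by omega)
  let σ : Fin 4 → Fin 4 := ![0, a, b, d]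
  have hσ : Function.Bijective σ := by
    refine (Fintype.bijective_iff_injective_and_card σ).2 ⟨?_, rfl⟩
    intro i j hij
    fin_cases i <;> fin_cases j <;> simp [σ] at hij ⊢ <;> omega
  have hTσ : T ∘ σ = faceCorners c (T 0) π π' := by
    funext i
    fin_cases i <;> simp [σ, faceCorners, h1, h2, h3]
  rw [← redDim_comp_perm T (Equiv.ofBijective σ hσ)]
  change redDim (T ∘ σ) = 6 ∨ redDim (T ∘ σ) = 7 ∨ redDim (T ∘ σ) = 8
  rw [hTσ]
  exact redDim_faceCorners_of_order8 hcl (hT 0) hpl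

end General

namespace Route

/-- **ROUTE.md §3.3's count for every face of every classified degree-8 type datum**: `D.redDim Δ ∈ {6, 7, 8}` whenever
`(D.G, D.c)` is classified and `Δ` is a face of the roster. -/
theorem TypeDatum.redDim_of_order8 (D : TypeDatum) (hcl : Order8Classified D.c) (Δ : Finset D.S)
    (hΔ : D.IsFace Δ) : D.redDim Δ = 6 ∨ D.redDim Δ = 7 ∨ D.redDim Δ = 8 := by
  obtain ⟨hcard, heq2, -, hconj⟩ := hΔ
  have hc4 : Fintype.card Δ = 4 := by rw [Fintype.card_coe, hcard]
  let e : Fin 4 ≃ Δ := (Fintype.equivFinOfCardEq hc4).symm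
  let T : Fin 4 → Finset D.G := fun i => D.liftedType (e i).1
  have hT : D.redDim Δ = HodgeRepro.redDim T := by
    unfold TypeDatum.redDim HodgeRepro.redDim
    congr 1
    ext x
    simp only [mem_image, mem_univ, true_and]
    constructor
    · rintro ⟨s, hs, rfl⟩
      exact ⟨e.symm ⟨s, hs⟩, by simp [T]⟩
    · rintro ⟨i, rfl⟩
      exact ⟨(e i).1, (e i).2, rfl⟩
  rw [hT]
  refine redDim_of_sumTwo_of_order8 hcl D.hc (fun i => D.liftedType_isCMType _) ?_ ?_
  · intro t
    rw [← heq2.sum_liftedType_eq D t]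
    refine Finset.card_bij (fun i _ => (e i).1) ?_ ?_ ?_
    · intro i hi
      simp only [mem_filter, mem_univ, true_and] at hi ⊢
      exact ⟨(e i).2, hi⟩
    · intro i _ j _ h
      exact e.injective (Subtype.ext h)
    · intro s hs
      simp only [mem_filter] at hs
      exact ⟨e.symm ⟨s, hs.1⟩, by simp [mem_filter, T, hs.2], by simp⟩
  · intro i j _
    exact hconj _ (e i).2 _ (e j).2

variable (𝓚 : KnownRegimeData)

/-- **The combinatorial count in degree 8** — every face of a type datum with `|G| = 8` has reduced dimension `6`, `7` or
`8` (ROUTE.md §3.3).  A theorem for every interface modulo the classification: `redDimDeg8_of_classify8`. -/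
def RedDimDeg8 : Prop :=
  ∀ A : 𝓚.Var, 𝓚.IsCM A → Fintype.card (𝓚.typeOf A).G = 8 →
    ∀ Δ : Finset (𝓚.typeOf A).S, (𝓚.typeOf A).IsFace Δ →
      (𝓚.typeOf A).redDim Δ = 6 ∨ (𝓚.typeOf A).redDim Δ = 7 ∨ (𝓚.typeOf A).redDim Δ = 8

/-- **The count is a theorem modulo the classification**: `TypeDatum.redDim_of_order8` on the type datum of every CM `A`
of degree 8. -/
theorem redDimDeg8_of_classify8 (hcl : Night4Classify8) : RedDimDeg8 𝓚 :=
  fun A _ hG Δ hΔ => TypeDatum.redDim_of_order8 _ (hcl _ _ hG (𝓚.typeOf A).hc) Δ hΔ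

/-- **The §3.3 count in the route's terms** (the cell's, UNPRINTED): the reduced variety of every face of a CM `A` whose
Galois CM field has degree 8 is an abelian variety of dimension `6`, `7` or `8` («dim B_red 6–8»). -/
def ReducedDimLeEight_deg8 : Prop :=
  ∀ A : 𝓚.Var, 𝓚.IsCM A → Fintype.card (𝓚.typeOf A).G = 8 →
    ∀ Δ : Finset (𝓚.typeOf A).S, (𝓚.typeOf A).IsFace Δ →
      𝓚.IsAbelian (𝓚.reduced A Δ) ∧ 6 ≤ 𝓚.dim (𝓚.reduced A Δ) ∧ 𝓚.dim (𝓚.reduced A Δ) ≤ 8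

/-- The count in the route's terms from the dictionary `DimReduced` and the kernel count (modulo the classification). -/
theorem ReducedDimLeEight_deg8_of_DimReduced (hD : DimReduced 𝓚) (hcl : Night4Classify8) :
    ReducedDimLeEight_deg8 𝓚 := by
  intro A hA hG Δ hΔ
  obtain ⟨hab, hdim⟩ := hD A hA Δ hΔ
  refine ⟨hab, ?_⟩
  rw [hdim]
  rcases redDimDeg8_of_classify8 𝓚 hcl A hA hG Δ hΔ with h | h | h <;> omega

/-- **HC in codimension 2 for the abelian varieties of dimension `≤ n`**: `B²(X) ⊂ alg²(X)` for every abelian variety `X`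
over `ℂ` with `dim X ≤ n`.  For `n ≤ 5` this is PRINTED (Markman 2025 Cor 1.3, `Markman2025_Cor1_3`, all codimensions);
for `n = 8` it is the statement that would close the degree-8 frontier (below). -/
def HC2_dim_le (n : ℕ) : Prop :=
  ∀ X : 𝓚.Var, 𝓚.IsAbelian X → 𝓚.dim X ≤ n → 𝓚.hodge 2 X ≤ 𝓚.alg 2 X

/-- Markman 2025 Corollary 1.3 gives `HC2_dim_le 5`. -/
theorem HC2_dim_le_five_of_Markman (hM : Markman2025_Cor1_3 𝓚) : HC2_dim_le 𝓚 5 :=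
  fun X hX hdim => hM X hX hdim 2

/-- **ROUTE.md §3.3's frontier in dimension terms**: `S4facesDeg 8 ⇐ AlgPull ∧ LemmaR_faces ∧ DimReduced ∧ Night4Classify8
∧ HC2_dim_le 8` — the degree-8 analogue of `S4facesDeg6_of_Markman'`: with Lemma R, the dictionary and the kernel count,
the Hodge conjecture in codimension 2 for abelian varieties of dimension `≤ 8` closes S4 on every degree-8 face (the
reduced products `A × E × E′`, `A × S`, `S × S′ × S″` in dimension 6, `A × S × E` in dimension 7, `A₁ × A₂`, `A × S × S′`,
`S₁ × S₂ × S₃ × S₄` in dimension 8 — ROUTE.md §3.3 / §3.5 (i)).  The hypothesis `HC2_dim_le 8` is OPEN in print (Markman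
Cor 1.3 stops at 5); nothing is closed here. -/
theorem S4facesDeg8_of_HC2_le_eight (hpull : AlgPull 𝓚.toRouteData) (hR : LemmaR_faces 𝓚) (hD : DimReduced 𝓚)
    (hcl : Night4Classify8) (hHC : HC2_dim_le 𝓚 8) : S4facesDeg 𝓚.toRouteData 8 := by
  intro A hA hG Δ hΔ
  obtain ⟨hab, -, hle⟩ := ReducedDimLeEight_deg8_of_DimReduced 𝓚 hD hcl A hA hG Δ hΔ
  exact weil_le_alg_of_face 𝓚 hpull hR hA hΔ (hHC _ hab hle)

/-- The same with `S4facesDeg 6` alongside: `HC2_dim_le 8` contains the `≤ 5` case, so it closes degree 6 as well (the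
count `redDim = 4` of gen 1). -/
theorem S4facesDeg6_of_HC2_le_eight (hpull : AlgPull 𝓚.toRouteData) (hR : LemmaR_faces 𝓚) (hD : DimReduced 𝓚)
    (hHC : HC2_dim_le 𝓚 8) : S4facesDeg 𝓚.toRouteData 6 := by
  intro A hA hG Δ hΔ
  obtain ⟨hab, hdim⟩ := ReducedFourfold_deg6_of_DimReduced 𝓚 hD A hA hG Δ hΔ
  exact weil_le_alg_of_face 𝓚 hpull hR hA hΔ (hHC _ hab (by omega))

end Route

end HodgeRepro
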